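import Literature.NumberTheory.LFunctions.WeilFirstPrimeQuadratic
import HarnessLib

/-!
# The analytic form of Weil's quadratic functional on the two-prime cone `C(log 2)`

For a test function `g` with `tsupport g ⊆ [-log 2, log 2]` the kernel `k = g ⋆ g̃` is supported in
`[-log 4, log 4]`, so exactly TWO prime powers enter the explicit formula, `n = 2` and `n = 3`
(`n = 4` sits on the boundary, where `k` vanishes because its support is open):
`W(k) = k^(0) + k^(1) − (log 2/√2)(k(log 2) + k(−log 2)) − (log 3/√3)(k(log 3) + k(−log 3)) + W_∞(k)`.
By Mellin (Fourier) inversion on the critical line, `2π (k(x) + k(−x)) = ∫ |ĝ(1/2+it)|² 2cos(tx) dt`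
for every real `x` (`weilConv_weilReflect_add_at`), so both primes are DIAGONAL in frequency and
Weil's quadratic functional takes Yoshida's analytic shape with a doubly rippled weight:

`Re Q(g) = E₂₃(g) := 2 Re(ĝ(0) conj ĝ(1)) − (log π)‖g‖₂² + (1/2π) ∫ |ĝ(1/2+it)|² w₂₃(t) dt`,
`w₂₃(t) = Re ψ(1/4 + it/2) − √2 log 2 · cos(t log 2) − (2 log 3/√3) · cos(t log 3)`
(`weilTwoPrimeWeight`, `weilTwoPrimeQuadratic`, `weilQuadratic_re_eq_weilTwoPrimeQuadratic`).

Hence Weil positivity on the cone `C(log 2)` (Yoshida's third rung, Connes' semi-local positivity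
for `S = {∞, 2, 3}`) is EQUIVALENT to `E₂₃ ≥ 0` on `C(log 2)` (`weilPositivityOn_log_two_iff`),
and every certified statement about the window `((log 3)/2, log 2]` (the `{2,3}`-window of the
parity ladders) reduces to this analytic form.  Everything here is proved; there are no named facts.

## References

* H. Yoshida, *On Hermitian forms attached to zeta functions*, Adv. Stud. Pure Math. 21 (1992),
  §2 eq. (2.1) (the analytic form; here with the `p = 2, 3` terms of (2.1) kept).
* E. Bombieri, *Remarks on Weil's quadratic functional in the theory of prime numbers I*, Rend.
  Mat. Acc. Lincei (9) 11 (2000), Thm 2 (explicit formula), §2 (Mellin inversion).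
* A. Connes, C. Consani, *Spectral triples and ζ-cycles*, arXiv:2106.01715, §2.3 (the semi-local
  Weil quadratic form with finitely many primes).
-/

noncomputable section

open Complex Filter Set MeasureTheory
open scoped Real Topology ComplexConjugate

namespace Literature.NumberTheory.LFunctions

variable {g : ℝ → ℂ}

/-! ## The doubly rippled weight and the analytic form -/

/-- The two-prime Weil weight
`w₂₃(t) = Re ψ(1/4 + it/2) − √2 log 2 · cos(t log 2) − (2 log 3/√3) · cos(t log 3)`: the
archimedean density of Yoshida's (2.1) minus the frequency-side images of the prime spikes
`(log 2/√2)(δ_{log 2} + δ_{−log 2})` and `(log 3/√3)(δ_{log 3} + δ_{−log 3})`. [cite: Yoshida1992, §2 eq. (2.1) with the p = 2, 3 terms] -/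
def weilTwoPrimeWeight (t : ℝ) : ℝ :=
  Literature.Analysis.SpecialFunctions.reDigammaQuarter t -
    Real.sqrt 2 * Real.log 2 * Real.cos (t * Real.log 2) -
    2 * Real.log 3 / Real.sqrt 3 * Real.cos (t * Real.log 3)

/-- The two-prime analytic form
`E₂₃(g) = 2 Re(ĝ(0) conj ĝ(1)) − (log π) ‖g‖₂² + (1/2π) ∫ |ĝ(1/2+it)|² w₂₃(t) dt`. [cite: Yoshida1992, §2 eq. (2.1) with the p = 2, 3 terms] -/
def weilTwoPrimeQuadratic (g : ℝ → ℂ) : ℝ :=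
  2 * (weilMellin g 0 * conj (weilMellin g 1)).re - Real.log π * weilNorm2Sq g +
    1 / (2 * π) * ∫ t : ℝ, ‖weilMellin g (1 / 2 + t * I)‖ ^ 2 * weilTwoPrimeWeight t

/-- The two-prime weight is the first-prime weight minus the prime-3 ripple. [folklore] -/
theorem weilTwoPrimeWeight_eq (t : ℝ) :
    weilTwoPrimeWeight t =
      weilFirstPrimeWeight t - 2 * Real.log 3 / Real.sqrt 3 * Real.cos (t * Real.log 3) := by
  unfold weilTwoPrimeWeight weilFirstPrimeWeight
  ring

/-- The weight is measurable. [folklore] -/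
theorem measurable_weilTwoPrimeWeight : Measurable weilTwoPrimeWeight :=
  (Literature.Analysis.SpecialFunctions.measurable_reDigammaQuarter.sub (by fun_prop)).sub
    (by fun_prop)

/-- `t ↦ |ĝ(1/2+it)|² · c · cos(t x)` is integrable for every real `c, x`. [folklore] -/
theorem integrable_norm_sq_weilMellin_mul_const_mul_cos (hg : IsWeilTest g) (c x : ℝ) :
    Integrable fun t : ℝ ↦ ‖weilMellin g (1 / 2 + t * I)‖ ^ 2 * (c * Real.cos (t * x)) :=
  integrable_norm_sq_weilMellin_mul hg (by fun_prop) (A := |c|) (B := 0) (abs_nonneg c) le_rfl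
    fun t ↦ by
      rw [zero_mul, add_zero, abs_mul]
      exact mul_le_of_le_one_right (abs_nonneg c) (Real.abs_cos_le_one _)

/-- `t ↦ |ĝ(1/2+it)|² w₂₃(t)` is integrable. [folklore] -/
theorem integrable_norm_sq_weilMellin_mul_weilTwoPrimeWeight (hg : IsWeilTest g) :
    Integrable fun t : ℝ ↦ ‖weilMellin g (1 / 2 + t * I)‖ ^ 2 * weilTwoPrimeWeight t := by
  have h1 := integrable_norm_sq_weilMellin_mul_weilFirstPrimeWeight hg
  have h2 := integrable_norm_sq_weilMellin_mul_const_mul_cos hg (2 * Real.log 3 / Real.sqrt 3)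
    (Real.log 3)
  have e : (fun t : ℝ ↦ ‖weilMellin g (1 / 2 + t * I)‖ ^ 2 * weilTwoPrimeWeight t) =
      fun t : ℝ ↦ ‖weilMellin g (1 / 2 + t * I)‖ ^ 2 * weilFirstPrimeWeight t -
        ‖weilMellin g (1 / 2 + t * I)‖ ^ 2 *
          (2 * Real.log 3 / Real.sqrt 3 * Real.cos (t * Real.log 3)) := by
    funext t; rw [weilTwoPrimeWeight_eq]; ring
  rw [e]
  exact h1.sub h2

/-! ## Only the primes 2 and 3 enter on the window `[-log 4, log 4]` -/

/-- For a continuous `k` with `tsupport k ⊆ [-log 4, log 4]` the prime term of `W` consists of the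
two spikes `(log 2/√2)(k(log 2) + k(−log 2)) + (log 3/√3)(k(log 3) + k(−log 3))`: `k(±log n) = 0`
for `n ≥ 4` because the support is open inside the closed window (`log n ≥ log 4`), and
`Λ(0) = Λ(1) = 0`. [cite: Bombieri2000Weil, Thm 2 (prime side) restricted to supp ⊆ [−log 4, log 4]] -/
theorem weilPrimeTerm_of_tsupport_subset_log_four {k : ℝ → ℂ} (hk : Continuous k)
    (hsupp : tsupport k ⊆ Icc (-Real.log 4) (Real.log 4)) :
    weilPrimeTerm k =
      ((Real.log 2 : ℝ) : ℂ) / (Real.sqrt 2 : ℂ) * (k (Real.log 2) + k (-Real.log 2)) +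
        ((Real.log 3 : ℝ) : ℂ) / (Real.sqrt 3 : ℂ) * (k (Real.log 3) + k (-Real.log 3)) := by
  have hIoo : Function.support k ⊆ Ioo (-Real.log 4) (Real.log 4) :=
    support_subset_Ioo_of_tsupport_subset_Icc hk hsupp
  have hzero : ∀ x : ℝ, Real.log 4 ≤ |x| → k x = 0 := by
    intro x hx
    by_contra hne
    have hmem := hIoo (Function.mem_support.2 hne)
    rw [mem_Ioo] at hmem
    have : |x| < Real.log 4 := abs_lt.2 ⟨hmem.1, hmem.2⟩
    linarith
  have hvan : ∀ n : ℕ, 4 ≤ n →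
      ((ArithmeticFunction.vonMangoldt n : ℝ) : ℂ) / (Real.sqrt n : ℂ) *
        (k (Real.log n) + k (-Real.log n)) = 0 := by
    intro n hn
    have hn' : (4 : ℝ) ≤ n := by exact_mod_cast hn
    have hlog : Real.log 4 ≤ Real.log n := Real.log_le_log (by norm_num) hn'
    have hpos : 0 ≤ Real.log n := (Real.log_nonneg (by norm_num)).trans hlog
    rw [hzero _ (by rwa [abs_of_nonneg hpos]), hzero _ (by rwa [abs_neg, abs_of_nonneg hpos])]
    simp
  unfold weilPrimeTerm
  have hfin : ∀ n ∉ ({2, 3} : Finset ℕ),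
      ((ArithmeticFunction.vonMangoldt n : ℝ) : ℂ) / (Real.sqrt n : ℂ) *
        (k (Real.log n) + k (-Real.log n)) = 0 := by
    intro n hn
    rcases Nat.lt_or_ge n 4 with h4 | h4
    · interval_cases n <;> simp_all
    · exact hvan n h4
  rw [tsum_eq_sum (s := ({2, 3} : Finset ℕ)) hfin, Finset.sum_pair (by norm_num)]
  push_cast
  rw [ArithmeticFunction.vonMangoldt_apply_prime Nat.prime_two,
    ArithmeticFunction.vonMangoldt_apply_prime Nat.prime_three]
  push_cast
  ring

/-! ## Every prime is diagonal in frequency -/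

/-- Mellin inversion on the critical line for the kernel `k = g ⋆ g̃` at the symmetric pair `±x`:
`2π (k(x) + k(−x)) = ∫ |ĝ(1/2+it)|² · 2cos(t x) dt` (as complex numbers). [cite: Bombieri2000Weil, §2 (inverse Mellin transform) applied to g ⋆ g̃ at t = ± x] -/
theorem weilConv_weilReflect_add_at (hg : IsWeilTest g) (x : ℝ) :
    2 * π * (weilConv g (weilReflect g) x + weilConv g (weilReflect g) (-x)) =
      ((∫ t : ℝ, ‖weilMellin g (1 / 2 + t * I)‖ ^ 2 * (2 * Real.cos (t * x)) : ℝ) : ℂ) := by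
  have hk : IsWeilTest (weilConv g (weilReflect g)) := hg.weilConv hg.weilReflect
  have h1 := weilMellin_inversion hk (1 / 2) x
  have h2 := weilMellin_inversion hk (1 / 2) (-x)
  have e0 : ((1 / 2 : ℝ) : ℂ) - 1 / 2 = 0 := by push_cast; ring
  simp only [e0, zero_mul, Complex.exp_zero, mul_one] at h1 h2
  have hb1 : ∀ y : ℝ, ‖cexp (-(y * I) * (x : ℝ))‖ ≤ 1 := fun y ↦ by
    rw [show -(y * I : ℂ) * (x : ℝ) = ((-(y * x) : ℝ) : ℂ) * I by push_cast; ring,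
      Complex.norm_exp_ofReal_mul_I]
  have hb2 : ∀ y : ℝ, ‖cexp (-(y * I) * ((-x : ℝ) : ℂ))‖ ≤ 1 := fun y ↦ by
    rw [show -(y * I : ℂ) * ((-x : ℝ) : ℂ) = (((y * x) : ℝ) : ℂ) * I by push_cast; ring,
      Complex.norm_exp_ofReal_mul_I]
  have hi1 : Integrable fun y : ℝ ↦
      weilMellin (weilConv g (weilReflect g)) ((1 / 2 : ℝ) + y * I) * cexp (-(y * I) * (x : ℝ)) :=
    integrable_weilMellin_vertical_mul hk (1 / 2) (by fun_prop) hb1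
  have hi2 : Integrable fun y : ℝ ↦
      weilMellin (weilConv g (weilReflect g)) ((1 / 2 : ℝ) + y * I) *
        cexp (-(y * I) * ((-x : ℝ) : ℂ)) :=
    integrable_weilMellin_vertical_mul hk (1 / 2) (by fun_prop) hb2
  rw [mul_add, ← h1, ← h2, ← integral_add hi1 hi2, ← integral_complex_ofReal]
  congr 1 with t
  have ht : ((1 / 2 : ℝ) : ℂ) + t * I = 1 / 2 + t * I := by push_cast; ring
  rw [ht, weilMellin_weilConv_weilReflect_half hg t]
  have hcos : cexp (-(t * I) * (x : ℝ)) + cexp (-(t * I) * ((-x : ℝ) : ℂ)) =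
      ((2 * Real.cos (t * x) : ℝ) : ℂ) := by
    have e1 : -(t * I : ℂ) * (x : ℝ) = -((t * x : ℝ) : ℂ) * I := by push_cast; ring
    have e2 : -(t * I : ℂ) * ((-x : ℝ) : ℂ) = ((t * x : ℝ) : ℂ) * I := by push_cast; ring
    rw [e1, e2, add_comm, ← Complex.two_cos]
    push_cast
    ring
  rw [← mul_add, hcos]
  push_cast
  ring

/-- The prime-`x` spike of the kernel as a frequency integral:
`k(x) + k(−x) = (1/2π) ∫ |ĝ(1/2+it)|² 2cos(tx) dt`. [folklore] -/
theorem weilConv_weilReflect_add_eq_integral (hg : IsWeilTest g) (x : ℝ) :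
    weilConv g (weilReflect g) x + weilConv g (weilReflect g) (-x) =
      (1 / (2 * π) : ℂ) *
        ((∫ t : ℝ, ‖weilMellin g (1 / 2 + t * I)‖ ^ 2 * (2 * Real.cos (t * x)) : ℝ) : ℂ) := by
  rw [← weilConv_weilReflect_add_at hg x]
  have hpi : (2 * π : ℂ) ≠ 0 := by
    have : (0 : ℝ) < 2 * π := by positivity
    exact_mod_cast this.ne'
  field_simp

/-! ## The analytic form on the two-prime cone -/

/-- `log p/√p = √p log p/p`-type rewriting: `log n / √n = √n · log n / n` for `0 < n`. [folklore] -/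
theorem log_div_sqrt_eq {n : ℝ} (hn : 0 < n) :
    Real.log n / Real.sqrt n = Real.sqrt n * Real.log n / n := by
  have hs : 0 < Real.sqrt n := Real.sqrt_pos.2 hn
  have h2 : Real.sqrt n ^ 2 = n := Real.sq_sqrt hn.le
  rw [div_eq_div_iff hs.ne' hn.ne']
  linear_combination (-Real.log n) * h2

/-- **`Q(g)` in analytic form on `C(log 2)`.** For `tsupport g ⊆ [-log 2, log 2]`,
`W(g ⋆ g̃) = E₂₃(g)` as a complex number: polar term `2 Re(ĝ(0) conj ĝ(1))`, prime terms
`(log 2/√2)·(1/2π)∫|ĝ|² 2cos(t log 2) + (log 3/√3)·(1/2π)∫|ĝ|² 2cos(t log 3)`, archimedean term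
`(1/2π)∫|ĝ|² Re ψ(1/4+it/2) − (log π)‖g‖₂²`.
[cite: Yoshida1992, §2 eq. (2.1) with the p = 2, 3 terms; ConnesConsani2023 §2.3] -/
theorem weilQuadratic_eq_weilTwoPrimeQuadratic (hg : IsWeilTest g)
    (hsupp : tsupport g ⊆ Icc (-Real.log 2) (Real.log 2)) :
    weilQuadratic g = (weilTwoPrimeQuadratic g : ℂ) := by
  have hk : IsWeilTest (weilConv g (weilReflect g)) := hg.weilConv hg.weilReflect
  have hlog4 : Real.log 4 = 2 * Real.log 2 := by
    rw [show (4 : ℝ) = 2 ^ 2 by norm_num, Real.log_pow]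
    push_cast
    ring
  have hks : tsupport (weilConv g (weilReflect g)) ⊆ Icc (-Real.log 4) (Real.log 4) := by
    have h := tsupport_weilConv_weilReflect_subset (a := Real.log 2) hg.2 hsupp
    rwa [← hlog4] at h
  -- the two spikes as frequency integrals
  have hp2 := weilConv_weilReflect_add_eq_integral hg (Real.log 2)
  have hp3 := weilConv_weilReflect_add_eq_integral hg (Real.log 3)
  -- the weighted integrals
  have hI1 := integrable_norm_sq_weilMellin_mul_reDigammaQuarter hg
  have hI2 : Integrable fun t : ℝ ↦
      ‖weilMellin g (1 / 2 + t * I)‖ ^ 2 * (2 * Real.cos (t * Real.log 2)) :=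
    integrable_norm_sq_weilMellin_mul_const_mul_cos hg 2 (Real.log 2)
  have hI3 : Integrable fun t : ℝ ↦
      ‖weilMellin g (1 / 2 + t * I)‖ ^ 2 * (2 * Real.cos (t * Real.log 3)) :=
    integrable_norm_sq_weilMellin_mul_const_mul_cos hg 2 (Real.log 3)
  have hsplit : ∫ t : ℝ, ‖weilMellin g (1 / 2 + t * I)‖ ^ 2 * weilTwoPrimeWeight t =
      (∫ t : ℝ, ‖weilMellin g (1 / 2 + t * I)‖ ^ 2 *
          Literature.Analysis.SpecialFunctions.reDigammaQuarter t) -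
        Real.sqrt 2 * Real.log 2 / 2 *
          (∫ t : ℝ, ‖weilMellin g (1 / 2 + t * I)‖ ^ 2 * (2 * Real.cos (t * Real.log 2))) -
        Real.log 3 / Real.sqrt 3 *
          ∫ t : ℝ, ‖weilMellin g (1 / 2 + t * I)‖ ^ 2 * (2 * Real.cos (t * Real.log 3)) := by
    have e : (fun t : ℝ ↦ ‖weilMellin g (1 / 2 + t * I)‖ ^ 2 * weilTwoPrimeWeight t) =
        fun t : ℝ ↦ (‖weilMellin g (1 / 2 + t * I)‖ ^ 2 *
            Literature.Analysis.SpecialFunctions.reDigammaQuarter t -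
          Real.sqrt 2 * Real.log 2 / 2 *
            (‖weilMellin g (1 / 2 + t * I)‖ ^ 2 * (2 * Real.cos (t * Real.log 2)))) -
          Real.log 3 / Real.sqrt 3 *
            (‖weilMellin g (1 / 2 + t * I)‖ ^ 2 * (2 * Real.cos (t * Real.log 3))) := by
      funext t
      unfold weilTwoPrimeWeight
      ring
    have hI2' : Integrable fun t : ℝ ↦ Real.sqrt 2 * Real.log 2 / 2 *
        (‖weilMellin g (1 / 2 + t * I)‖ ^ 2 * (2 * Real.cos (t * Real.log 2))) := hI2.const_mul _
    have hI3' : Integrable fun t : ℝ ↦ Real.log 3 / Real.sqrt 3 *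
        (‖weilMellin g (1 / 2 + t * I)‖ ^ 2 * (2 * Real.cos (t * Real.log 3))) := hI3.const_mul _
    have hI12 : Integrable fun t : ℝ ↦ ‖weilMellin g (1 / 2 + t * I)‖ ^ 2 *
          Literature.Analysis.SpecialFunctions.reDigammaQuarter t -
        Real.sqrt 2 * Real.log 2 / 2 *
          (‖weilMellin g (1 / 2 + t * I)‖ ^ 2 * (2 * Real.cos (t * Real.log 2))) := hI1.sub hI2'
    rw [e, integral_sub hI12 hI3', integral_sub hI1 hI2', integral_const_mul, integral_const_mul]
  have hsqrt2 : Real.log 2 / Real.sqrt 2 = Real.sqrt 2 * Real.log 2 / 2 :=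
    log_div_sqrt_eq two_pos
  unfold weilQuadratic weilFunctional weilArchTerm weilTwoPrimeQuadratic
  rw [weilPrimeTerm_of_tsupport_subset_log_four hk.1.continuous hks, hp2, hp3,
    weilPolarTerm_weilConv_weilReflect hg, weilArchIntegral_weilConv_weilReflect hg,
    weilConv_weilReflect_apply_zero, hsplit]
  unfold weilNorm2Sq Literature.Analysis.SpecialFunctions.reDigammaQuarter
  rw [show ((Real.log 2 : ℝ) : ℂ) / (Real.sqrt 2 : ℂ) = ((Real.log 2 / Real.sqrt 2 : ℝ) : ℂ) by
      push_cast; ring,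
    show ((Real.log 3 : ℝ) : ℂ) / (Real.sqrt 3 : ℂ) = ((Real.log 3 / Real.sqrt 3 : ℝ) : ℂ) by
      push_cast; ring,
    hsqrt2]
  push_cast
  ring

/-- Real-part version: `Re Q(g) = E₂₃(g)` on `C(log 2)`. [cite: Yoshida1992, §2 eq. (2.1) with the p = 2, 3 terms] -/
theorem weilQuadratic_re_eq_weilTwoPrimeQuadratic (hg : IsWeilTest g)
    (hsupp : tsupport g ⊆ Icc (-Real.log 2) (Real.log 2)) :
    (weilQuadratic g).re = weilTwoPrimeQuadratic g := by
  rw [weilQuadratic_eq_weilTwoPrimeQuadratic hg hsupp, Complex.ofReal_re]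

/-- On `C(log 2)` the quadratic functional is real: `Im Q(g) = 0`. [folklore] -/
theorem weilQuadratic_im_eq_zero_of_tsupport_subset_log_two (hg : IsWeilTest g)
    (hsupp : tsupport g ⊆ Icc (-Real.log 2) (Real.log 2)) :
    (weilQuadratic g).im = 0 := by
  rw [weilQuadratic_eq_weilTwoPrimeQuadratic hg hsupp, Complex.ofReal_im]

/-- The two-prime form extends the first-prime form: on `C((log 3)/2)` they agree
(the prime-3 spikes `k(±log 3)` vanish there). [folklore] -/
theorem weilTwoPrimeQuadratic_eq_weilFirstPrimeQuadratic (hg : IsWeilTest g)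
    (hsupp : tsupport g ⊆ Icc (-(Real.log 3 / 2)) (Real.log 3 / 2)) :
    weilTwoPrimeQuadratic g = weilFirstPrimeQuadratic g := by
  have h3 : Real.log 3 / 2 ≤ Real.log 2 := by
    have h34 : Real.log 3 ≤ Real.log 4 := Real.log_le_log (by norm_num) (by norm_num)
    rw [show (4 : ℝ) = 2 ^ 2 by norm_num, Real.log_pow] at h34
    push_cast at h34
    linarith
  have hsupp' : tsupport g ⊆ Icc (-Real.log 2) (Real.log 2) :=
    hsupp.trans (Icc_subset_Icc (by linarith) h3)
  have h := weilQuadratic_eq_weilTwoPrimeQuadratic hg hsupp'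
  rw [weilQuadratic_eq_weilFirstPrimeQuadratic hg hsupp] at h
  exact_mod_cast h.symm

/-- **Reduction of two-prime Weil positivity to its analytic form**:
`WeilPositivityOn (log 2) ↔ ∀ g ∈ C(log 2), 0 ≤ E₂₃(g)`. [cite: Yoshida1992, Thm 1 shape (§6) transported to a = log 2 with the p = 2, 3 terms] -/
theorem weilPositivityOn_log_two_iff :
    WeilPositivityOn (Real.log 2) ↔
      ∀ g : ℝ → ℂ, IsWeilTest g → tsupport g ⊆ Icc (-Real.log 2) (Real.log 2) →
        0 ≤ weilTwoPrimeQuadratic g := by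
  unfold WeilPositivityOn
  refine forall₃_congr fun g hg hsupp ↦ ?_
  rw [weilQuadratic_re_eq_weilTwoPrimeQuadratic hg hsupp]

/-- The direction a certificate uses: `E₂₃ ≥ 0` on `C(log 2)` implies `WeilPositivityOn (log 2)`. [cite: Yoshida1992, Thm 1 shape (§6) transported to a = log 2 with the p = 2, 3 terms] -/
theorem weilPositivityOn_log_two_of_weilTwoPrimeQuadratic_nonneg
    (h : ∀ g : ℝ → ℂ, IsWeilTest g → tsupport g ⊆ Icc (-Real.log 2) (Real.log 2) →
      0 ≤ weilTwoPrimeQuadratic g) :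
    WeilPositivityOn (Real.log 2) :=
  weilPositivityOn_log_two_iff.2 h

end Literature.NumberTheory.LFunctions
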